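import Summits.ValiantsHypothesis.ValiantsHypothesis.Theorems.NcIntervalProjection
import Literature.Computability.AlgebraicComplexity.SetMultilinearProjectionCircuit
import HarnessLib

/-!
# Noncommutative circuits for the ordered permanent ⇒ syntactically multilinear circuits for `per`

Hrubeš–Wigderson–Yehudayoff (STOC 2010 / ECCC TR10-021, "Relationless completeness and separations",
Theorem 1.11 and Theorem F.1), specialised to the permanent and carried out in the tree's straight-line
circuit model (`ArithCircuit`, gate lists grown at the end) with the noncommutative semantics `ncEval`
of `Theorems.CommutativityDial`: a noncommutative circuit of size `s` computing an ORDERED degree-`r`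
polynomial (every monomial reads its variables in the order of their "positions") can be simulated by
an ordered — hence syntactically multilinear — commutative circuit of size `O(r³ s)`; the gates of the
new circuit are the pairs `(v, I)`, `v` an old gate and `I = [j, j + m)` an interval of positions,
`(v, I)` computing the part of the noncommutative polynomial of `v` made of the words whose letters sit
at the consecutive positions of `I` (`ordProj`), sums componentwise and products by the convolution
`(v, [j, j+m)) = Σ_l (v₁, [j, j+l)) · (v₂, [j+l, j+m))` (`ordProj_mul`).

**What is proved.**
* (in `Theorems.NcIntervalProjection`) `ordProj col j m`, the interval projection of the free algebra
  to commutative polynomials for a position map `col : σ → ℕ`, is linear, treats generators and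
  constants as HWY prescribe and satisfies the convolution rule `ordProj_mul`; the full-interval part
  of the ordered permanent is `perPoly (Fin n)` (`ordProj_ncPerPoly`).
* `exists_sm_of_nc` (HWY10 Thm F.1 for the permanent, every commutative semiring): a fan-in-two
  circuit `P` with `ncEval P = ncPerPoly n` yields a fan-in-two SYNTACTICALLY MULTILINEAR circuit
  computing `perPoly (Fin n)` of size `≤ 64 (n+1)^4 (P.size + 1)` (the true count is
  `≤ 2 (n+1)³ · P.size`; the stated constant is the one typed in `Theorems.CommutativityDial`).
* Consequences for the decomposition node `CommutativityDial` (lens 6 of the `decomp-valiant`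
  workshop), now UNCONDITIONAL kernel edges: `PerNotSmVP → PerNotNcVP`
  (`perNotNcVP_of_perNotSmVP`: the gen-2 syntactically-multilinear hardness crux 23661 implies the
  noncommutative hardness conjunct) and `NcLift → TameOrSmLift` (`tameOrSmLift_of_ncLift`: the
  noncommutative residual implies the gen-2 residual 23662) — the commutativity dial sits BELOW the
  multilinearity dial on the hardness side and ABOVE it on the lifting side.

The circuit bookkeeping reuses the availability-with-budget toolkit of
`Literature/…/SetMultilinearProjectionCircuit.lean` (`SmlHomogenise.extend_lin`, `extend_prodSum`,
`iterate_targets`; Raz–Yehudayoff syntactic variable sets): the budget of the gate `(v, [j, j+m))` is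
the set of variables whose position lies in `[j, j+m)`, and the factors of the convolution live in the
disjoint budgets `[j, j+l)` and `[j+l, j+m)` — this is where syntactic multilinearity comes from.
HONEST FRAMING: a published simulation, formalised; nothing here bears on `VP ≠ VNP` beyond placing the
noncommutative pieces of the node against the syntactically multilinear ones.

## References
* [HrubesWigdersonYehudayoff2010] P. Hrubeš, A. Wigderson, A. Yehudayoff, Relationless completeness and
  separations, CCC 2010 (full version ECCC TR10-021), Thm 1.11, Thm F.1.
* [Nisan1991Noncommutative] N. Nisan, Lower bounds for non-commutative computation, STOC 1991.
* [RazYehudayoff2008] R. Raz, A. Yehudayoff, Comput. Complexity 17 (2008), §2.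
-/

noncomputable section

namespace Summit.ValiantsHypothesis.ValiantsHypothesis.Theorems.NcOrderedTransfer

open Literature.Computability.AlgebraicComplexity hiding ncPerPoly
open Literature.Computability.AlgebraicComplexity.ArithCircuit hiding ncGateValues ncEval ncGateValues_append_singleton
open Summit.ValiantsHypothesis.ValiantsHypothesis.Theorems.CommutativityDial
open Summit.ValiantsHypothesis.ValiantsHypothesis.Theses.DecompCycle1 (PerNotSmVP TameOrSmLift)
open MvPolynomial

universe u v

variable {R : Type u} [CommSemiring R] {σ : Type v} (col : σ → ℕ)

open Summit.ValiantsHypothesis.ValiantsHypothesis.Theorems.NcIntervalProjection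

/-! ## §3 Budgets and targets -/

section Circuit

variable [Fintype σ] [DecidableEq σ]

/-- The variable budget of the interval `[j, j+m)`: the variables whose position lies in it.
[cite: HrubesWigdersonYehudayoff2010, Thm F.1] -/
def colVars (j m : ℕ) : Finset σ :=
  Finset.univ.filter fun x => j ≤ col x ∧ col x < j + m

omit [DecidableEq σ] in
/-- Membership in a budget. [cite: HrubesWigdersonYehudayoff2010, Thm F.1] -/
@[simp] theorem mem_colVars {j m : ℕ} {x : σ} : x ∈ colVars col j m ↔ j ≤ col x ∧ col x < j + m := by
  simp [colVars]

omit [DecidableEq σ] in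
/-- The two halves of a split interval have DISJOINT budgets (the source of syntactic
multilinearity). [cite: HrubesWigdersonYehudayoff2010, Thm F.1] -/
theorem disjoint_colVars_split (j l m' : ℕ) :
    Disjoint (colVars col j l) (colVars col (j + l) m') := by
  rw [Finset.disjoint_left]
  intro x h₁ h₂
  rw [mem_colVars] at h₁ h₂
  omega

omit [DecidableEq σ] in
/-- Left half inside the whole. [cite: HrubesWigdersonYehudayoff2010, Thm F.1] -/
theorem colVars_left_subset {j l m : ℕ} (h : l ≤ m) : colVars col j l ⊆ colVars col j m := by
  intro x hx; rw [mem_colVars] at hx ⊢; omega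

omit [DecidableEq σ] in
/-- Right half inside the whole. [cite: HrubesWigdersonYehudayoff2010, Thm F.1] -/
theorem colVars_right_subset {j l m : ℕ} (h : l ≤ m) :
    colVars col (j + l) (m - l) ⊆ colVars col j m := by
  intro x hx; rw [mem_colVars] at hx ⊢; omega

/-- The intervals `[j, j+m) ⊆ [0, n)` — the second coordinates of HWY's gates `(v, I)` (plus the
empty intervals `m = 0`). [cite: HrubesWigdersonYehudayoff2010, Thm F.1] -/
def targets (n : ℕ) : Finset (ℕ × ℕ) :=
  (Finset.range (n + 1) ×ˢ Finset.range (n + 1)).filter fun jm => jm.1 + jm.2 ≤ n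

/-- Membership. [cite: HrubesWigdersonYehudayoff2010, Thm F.1] -/
theorem mem_targets {n j m : ℕ} : (j, m) ∈ targets n ↔ j + m ≤ n := by
  simp only [targets, Finset.mem_filter, Finset.mem_product, Finset.mem_range]
  omega

/-- At most `(n+1)²` intervals. [cite: HrubesWigdersonYehudayoff2010, Thm F.1] -/
theorem card_targets_le (n : ℕ) : (targets n).card ≤ (n + 1) ^ 2 := by
  refine (Finset.card_filter_le _ _).trans ?_
  rw [Finset.card_product, Finset.card_range, sq]

/-! ## §4 The ordered circuit, gate by gate (availability with budgets) -/

omit [Fintype σ] in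
/-- Constants are free. [cite: Burgisser2000, Def. 2.1] -/
theorem avail_C (gs : List (Gate R σ)) (c : R) (W : Finset σ) :
    (∃ u : Operand R σ, u.RefsBelow gs.length ∧ u.eval (gateValues gs) = C c ∧
      operandVarSet (gateVarSets gs) u ⊆ W) :=
  SmlHomogenise.avail_C gs c W

omit [Fintype σ] in
/-- Zero is free. [cite: Burgisser2000, Def. 2.1] -/
theorem avail_zero (gs : List (Gate R σ)) (W : Finset σ) :
    (∃ u : Operand R σ, u.RefsBelow gs.length ∧ u.eval (gateValues gs) = 0 ∧
      operandVarSet (gateVarSets gs) u ⊆ W) := by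
  simpa using avail_C gs (0 : R) W

omit [Fintype σ] in
/-- An `if`-split target whose branches are available is available. [cite: Burgisser2000, Def. 2.1] -/
theorem avail_ite {gs : List (Gate R σ)} {c : Prop} [Decidable c] {p q : MvPolynomial σ R}
    {W : Finset σ}
    (hp : c → (∃ u : Operand R σ, u.RefsBelow gs.length ∧ u.eval (gateValues gs) = p ∧
      operandVarSet (gateVarSets gs) u ⊆ W))
    (hq : ¬c → (∃ u : Operand R σ, u.RefsBelow gs.length ∧ u.eval (gateValues gs) = q ∧
      operandVarSet (gateVarSets gs) u ⊆ W)) :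
    (∃ u : Operand R σ, u.RefsBelow gs.length ∧ u.eval (gateValues gs) = (if c then p else q) ∧
      operandVarSet (gateVarSets gs) u ⊆ W) := by
  by_cases h : c
  · rw [if_pos h]; exact hp h
  · rw [if_neg h]; exact hq h

/-- **Operands.** If every interval part of every earlier noncommutative gate value is available
(budget = the interval's variables), then so is every interval part of the value of any operand:
a variable `x` contributes `x` at its own position and `0` elsewhere, a constant only at the empty
interval, a junk reference reads `0`. [cite: HrubesWigdersonYehudayoff2010, Thm F.1] -/
theorem avail_ncOperand {n : ℕ} {gs : List (Gate R σ)} (vals : List (FreeAlgebra R σ))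
    (hvals : ∀ p ∈ vals, ∀ jm ∈ targets n,
      ∃ u : Operand R σ, u.RefsBelow gs.length ∧ u.eval (gateValues gs) = ordProj col jm.1 jm.2 p ∧
        operandVarSet (gateVarSets gs) u ⊆ colVars col jm.1 jm.2)
    (o : Operand R σ) {j m : ℕ} (hjm : (j, m) ∈ targets n) :
    ∃ u : Operand R σ, u.RefsBelow gs.length ∧
      u.eval (gateValues gs) = ordProj col j m (ncOperandEval vals o) ∧
      operandVarSet (gateVarSets gs) u ⊆ colVars col j m := by
  cases o with
  | var x =>
    rw [ncOperandEval, ordProj_ι]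
    refine avail_ite (fun h => ⟨.var x, trivial, rfl, ?_⟩) fun _ => avail_zero gs _
    intro y hy
    simp only [operandVarSet, Finset.mem_singleton] at hy
    subst hy
    rw [mem_colVars]; omega
  | const c =>
    rw [ncOperandEval, ordProj_algebraMap]
    exact avail_ite (fun _ => avail_C gs c _) fun _ => avail_zero gs _
  | gate i =>
    simp only [ncOperandEval, List.getD_eq_getElem?_getD]
    by_cases hi : i < vals.length
    · rw [List.getElem?_eq_getElem hi, Option.getD_some]
      exact hvals _ (List.getElem_mem hi) (j, m) hjm
    · rw [List.getElem?_eq_none_iff.mpr (Nat.le_of_not_lt hi), Option.getD_none, map_zero]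
      exact avail_zero gs _

/-- **One gate.** From the interval parts of the values of its operands, at most `2 (n+1)` appended
gates per interval make every interval part of the value of one fan-in-two noncommutative gate
available, keeping fan-in two and syntactic multilinearity: a sum gate componentwise (one gate), a
product gate by the convolution `(v,[j,j+m)) = Σ_{l ≤ m} (v₁,[j,j+l)) · (v₂,[j+l,j+m))` whose factors
live in the disjoint budgets of the two half-intervals (`2 (m+1)` gates).
[cite: HrubesWigdersonYehudayoff2010, Thm F.1] -/
theorem extend_ncGate (n : ℕ) {gs : List (Gate R σ)} (h2 : ∀ g ∈ gs, g.fanIn ≤ 2)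
    (hsm : IsSyntacticallyMultilinear (⟨gs, Operand.gate 0⟩ : ArithCircuit R σ))
    (vals : List (FreeAlgebra R σ))
    (hops : ∀ (o : Operand R σ), ∀ jm ∈ targets n, ∃ u : Operand R σ, u.RefsBelow gs.length ∧
      u.eval (gateValues gs) = ordProj col jm.1 jm.2 (ncOperandEval vals o) ∧
      operandVarSet (gateVarSets gs) u ⊆ colVars col jm.1 jm.2)
    (g : Gate R σ) (hg : g.fanIn ≤ 2) :
    ∃ gs' : List (Gate R σ), gs <+: gs' ∧ (∀ g ∈ gs', g.fanIn ≤ 2) ∧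
      IsSyntacticallyMultilinear (⟨gs', Operand.gate 0⟩ : ArithCircuit R σ) ∧
      gs'.length ≤ gs.length + 2 * (n + 1) * (targets n).card ∧
      ∀ jm ∈ targets n, ∃ u : Operand R σ, u.RefsBelow gs'.length ∧
        u.eval (gateValues gs') = ordProj col jm.1 jm.2 (ncGateEval vals g) ∧
        operandVarSet (gateVarSets gs') u ⊆ colVars col jm.1 jm.2 := by
  classical
  refine SmlHomogenise.iterate_targets (targets n)
    (fun jm => ordProj col jm.1 jm.2 (ncGateEval vals g)) (fun jm => colVars col jm.1 jm.2)
    (2 * (n + 1)) h2 hsm ?_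
  rintro ⟨j, m⟩ hjm gs' hpre h2' hsm'
  have hm : m ≤ n := by have := mem_targets.1 hjm; omega
  have hops' : ∀ (o : Operand R σ), ∀ jm ∈ targets n, ∃ u : Operand R σ, u.RefsBelow gs'.length ∧
      u.eval (gateValues gs') = ordProj col jm.1 jm.2 (ncOperandEval vals o) ∧
      operandVarSet (gateVarSets gs') u ⊆ colVars col jm.1 jm.2 :=
    fun o jm h => SmlHomogenise.avail_mono hpre (hops o jm h)
  cases g with
  | sum args =>
    match args, hg with
    | [], _ =>
      refine ⟨gs', List.prefix_rfl, h2', hsm', by omega, ?_⟩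
      simp only [ncGateEval, List.map_nil, List.sum_nil, map_zero]
      exact avail_zero gs' _
    | [(a, o)], _ =>
      obtain ⟨gs'', hpre'', h2'', hsm'', hlen'', hav⟩ :=
        SmlHomogenise.extend_lin h2' hsm' a (0 : R) (hops' o (j, m) hjm) (hops' o (j, m) hjm)
      refine ⟨gs'', hpre'', h2'', hsm'', by omega, SmlHomogenise.avail_congr ?_ hav⟩
      simp [ncGateEval, map_smul]
    | [(a, o), (b, o')], _ =>
      obtain ⟨gs'', hpre'', h2'', hsm'', hlen'', hav⟩ :=
        SmlHomogenise.extend_lin h2' hsm' a b (hops' o (j, m) hjm) (hops' o' (j, m) hjm)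
      refine ⟨gs'', hpre'', h2'', hsm'', by omega, SmlHomogenise.avail_congr ?_ hav⟩
      simp [ncGateEval, map_smul]
    | _ :: _ :: _ :: _, hg => simp [Gate.fanIn, Gate.args] at hg
  | prod args =>
    match args, hg with
    | [], _ =>
      refine ⟨gs', List.prefix_rfl, h2', hsm', by omega, ?_⟩
      simp only [ncGateEval, List.map_nil, List.prod_nil, ordProj_one]
      exact avail_ite (fun _ => by simpa using avail_C gs' (1 : R) (colVars col j m))
        fun _ => avail_zero gs' _
    | [o], _ =>
      refine ⟨gs', List.prefix_rfl, h2', hsm', by omega, SmlHomogenise.avail_congr ?_ (hops' o (j, m) hjm)⟩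
      simp [ncGateEval]
    | [o, o'], _ =>
      obtain ⟨gs'', hpre'', h2'', hsm'', hlen'', hav⟩ :=
        SmlHomogenise.extend_prodSum (Finset.range (m + 1)) h2' hsm'
          (fun l => ordProj col j l (ncOperandEval vals o))
          (fun l => ordProj col (j + l) (m - l) (ncOperandEval vals o'))
          (fun l => colVars col j l) (fun l => colVars col (j + l) (m - l)) (colVars col j m)
          (fun l _ => disjoint_colVars_split col j l (m - l))
          (fun l hl => colVars_left_subset col (by have := Finset.mem_range.1 hl; omega))
          (fun l hl => colVars_right_subset col (by have := Finset.mem_range.1 hl; omega))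
          (fun l hl => hops' o (j, l) (mem_targets.2 (by
            have := Finset.mem_range.1 hl; have := mem_targets.1 hjm; omega)))
          (fun l hl => hops' o' (j + l, m - l) (mem_targets.2 (by
            have := Finset.mem_range.1 hl; have := mem_targets.1 hjm; omega)))
      refine ⟨gs'', hpre'', h2'', hsm'', ?_, SmlHomogenise.avail_congr ?_ hav⟩
      · rw [Finset.card_range] at hlen''
        have : 2 * (m + 1) ≤ 2 * (n + 1) := by omega
        omega
      · simp only [ncGateEval, List.map_cons, List.map_nil, List.prod_cons, List.prod_nil, mul_one]
        rw [ordProj_mul]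
    | _ :: _ :: _ :: _, hg => simp [Gate.fanIn, Gate.args] at hg

/-- **All gates**: every interval part of every noncommutative gate value of a fan-in-two gate list
`cs`, at `2 (n+1) · #targets` appended gates per gate of `cs` (induction along the left fold
`ncGateValues`). [cite: HrubesWigdersonYehudayoff2010, Thm F.1] -/
theorem extend_ncGates (n : ℕ) (cs : List (Gate R σ)) (hcs : ∀ g ∈ cs, g.fanIn ≤ 2) :
    ∃ gs : List (Gate R σ), (∀ g ∈ gs, g.fanIn ≤ 2) ∧
      IsSyntacticallyMultilinear (⟨gs, Operand.gate 0⟩ : ArithCircuit R σ) ∧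
      gs.length ≤ 2 * (n + 1) * (targets n).card * cs.length ∧
      ∀ p ∈ ncGateValues cs, ∀ jm ∈ targets n, ∃ u : Operand R σ, u.RefsBelow gs.length ∧
        u.eval (gateValues gs) = ordProj col jm.1 jm.2 p ∧
        operandVarSet (gateVarSets gs) u ⊆ colVars col jm.1 jm.2 := by
  induction cs using List.reverseRecOn with
  | nil =>
    refine ⟨[], by simp, isSyntacticallyMultilinear_of_gates_eq_nil rfl, by simp, fun p hp => ?_⟩
    simp [ncGateValues] at hp
  | append_singleton cs g ih =>
    obtain ⟨gs₁, h2₁, hsm₁, hlen₁, havail₁⟩ := ih fun g' hg' => hcs g' (List.mem_append_left _ hg')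
    have hops : ∀ (o : Operand R σ), ∀ jm ∈ targets n, ∃ u : Operand R σ,
        u.RefsBelow gs₁.length ∧
        u.eval (gateValues gs₁) = ordProj col jm.1 jm.2 (ncOperandEval (ncGateValues cs) o) ∧
        operandVarSet (gateVarSets gs₁) u ⊆ colVars col jm.1 jm.2 :=
      fun o jm hjm => avail_ncOperand col (ncGateValues cs) havail₁ o (j := jm.1) (m := jm.2) hjm
    obtain ⟨gs₂, hpre₂, h2₂, hsm₂, hlen₂, havail₂⟩ :=
      extend_ncGate col n h2₁ hsm₁ (ncGateValues cs) hops g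
        (hcs g (List.mem_append_right _ (List.mem_singleton_self g)))
    refine ⟨gs₂, h2₂, hsm₂, ?_, fun p hp jm hjm => ?_⟩
    · simp only [List.length_append, List.length_singleton]
      rw [Nat.mul_succ]; omega
    · rw [ncGateValues_append_singleton, List.mem_append, List.mem_singleton] at hp
      rcases hp with hp | rfl
      · exact SmlHomogenise.avail_mono hpre₂ (havail₁ p hp jm hjm)
      · exact havail₂ jm hjm

end Circuit

/-! ## §5 HWY10 Theorem F.1 for the permanent -/

/-- **Noncommutative ⇒ syntactically multilinear, for the permanent** (Hrubeš–Wigderson–Yehudayoff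
2010, Thm 1.11 / Thm F.1, in the tree's model, over every commutative semiring): a fan-in-two circuit
`P` whose NONCOMMUTATIVE value is the ordered permanent `ncPerPoly n` yields a fan-in-two
syntactically multilinear circuit computing `perPoly (Fin n)` of size `≤ 64 (n+1)^4 (P.size + 1)`
(in fact `≤ 2 (n+1)³ · P.size`: gates `(v, [j, j+m))`, `j + m ≤ n`, `≤ 2 (n+1)` of them per pair).
[cite: HrubesWigdersonYehudayoff2010, Thm F.1] -/
theorem exists_sm_of_nc (n : ℕ) (P : ArithCircuit R (Fin n × Fin n)) (hP : P.IsFanInTwo)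
    (hnc : ncEval P = ncPerPoly n) :
    ∃ Q : ArithCircuit R (Fin n × Fin n), Q.IsFanInTwo ∧ IsSyntacticallyMultilinear Q ∧
      Q.Computes (perPoly (Fin n) R) ∧ Q.size ≤ 64 * (n + 1) ^ 4 * (P.size + 1) := by
  classical
  obtain ⟨gs, h2, hsm, hlen, havail⟩ :=
    extend_ncGates (fun x : Fin n × Fin n => (x.2 : ℕ)) n P.gates hP
  obtain ⟨u, -, hval, -⟩ :=
    avail_ncOperand (fun x : Fin n × Fin n => (x.2 : ℕ)) (gs := gs) (ncGateValues P.gates) havail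
      P.output (j := 0) (m := n) (mem_targets.2 (by omega))
  refine ⟨⟨gs, u⟩, h2, (SmAppend.isSyntacticallyMultilinear_iff_gates gs (Operand.gate 0) u).mp hsm,
    ?_, ?_⟩
  · show u.eval (gateValues gs) = perPoly (Fin n) R
    rw [hval, show ncOperandEval (ncGateValues P.gates) P.output = ncEval P from rfl, hnc,
      ordProj_ncPerPoly]
  · show gs.length ≤ 64 * (n + 1) ^ 4 * (P.gates.length + 1)
    have hT := card_targets_le n
    have h1 : 2 * (n + 1) * (targets n).card * P.gates.length ≤
        2 * (n + 1) * (n + 1) ^ 2 * (P.gates.length + 1) :=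
      Nat.mul_le_mul (Nat.mul_le_mul_left _ hT) (Nat.le_succ _)
    have h2' : 2 * (n + 1) * (n + 1) ^ 2 ≤ 64 * (n + 1) ^ 4 := by
      have : (n + 1) * (n + 1) ^ 2 ≤ (n + 1) ^ 4 := by
        rw [← pow_succ']; exact Nat.pow_le_pow_right (Nat.succ_pos n) (by norm_num)
      calc 2 * (n + 1) * (n + 1) ^ 2 = 2 * ((n + 1) * (n + 1) ^ 2) := by ring
        _ ≤ 64 * (n + 1) ^ 4 := Nat.mul_le_mul (by norm_num) this
    exact hlen.trans (h1.trans (Nat.mul_le_mul_right _ h2'))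

/-! ## §6 Consequences for the node `CommutativityDial`: the transfer hypothesis discharged -/

/-- **HWY transfer, as typed in `Theorems.CommutativityDial` §5** (the hypothesis `hT` there), now a
theorem. [cite: HrubesWigdersonYehudayoff2010, Thm F.1] -/
theorem ncToSmTransfer : ∀ (n : ℕ) (P : ArithCircuit ℂ (Fin n × Fin n)), P.IsFanInTwo →
    ncEval P = ncPerPoly n →
      ∃ Q : ArithCircuit ℂ (Fin n × Fin n), Q.IsFanInTwo ∧ IsSyntacticallyMultilinear Q ∧
        Q.Computes (perPoly (Fin n) ℂ) ∧ Q.size ≤ 64 * (n + 1) ^ 4 * (P.size + 1) :=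
  fun n P hP hnc => exists_sm_of_nc n P hP hnc

/-- **`PerNotSmVP ⟹ PerNotNcVP`, unconditionally** (kernel edge from the gen-2 crux 23661 to the
noncommutative hardness conjunct of the node): superpolynomial hardness of `per` for syntactically
multilinear circuits implies it for noncommutative circuits computing the ordered permanent.
[cite: HrubesWigdersonYehudayoff2010, Thm 1.11] -/
theorem perNotNcVP_of_perNotSmVP (hA : PerNotSmVP) : PerNotNcVP :=
  CommutativityDial.perNotNcVP_of_perNotSmVP ncToSmTransfer hA

/-- **`NcLift ⟹` the syntactically-multilinear lift of `per`, unconditionally**: under `VP = VNP`, a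
polynomial-size noncommutative circuit family for the ordered permanents gives a polynomial-size
syntactically multilinear one for the permanents. [cite: HrubesWigdersonYehudayoff2010, Thm 1.11] -/
theorem smLiftPer_of_ncLift (hB : NcLift) (heq : VP ℂ = VNP ℂ) :
    ∃ c : ℕ, ∀ n : ℕ, ∃ P : ArithCircuit ℂ (Fin n × Fin n), P.IsFanInTwo ∧
      IsSyntacticallyMultilinear P ∧ P.Computes (perPoly (Fin n) ℂ) ∧ P.size ≤ n ^ c + c :=
  CommutativityDial.smLiftPer_of_ncLift ncToSmTransfer hB heq

/-- **`NcLift ⟹ TameOrSmLift`, unconditionally** (kernel edge from the noncommutative residual of the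
node to the gen-2 residual 23662): the commutativity dial's residual is at least as strong as the
multilinearity dial's. [cite: HrubesWigdersonYehudayoff2010, Thm 1.11] -/
theorem tameOrSmLift_of_ncLift (hB : NcLift) : TameOrSmLift :=
  CommutativityDial.tameOrSmLift_of_ncLift ncToSmTransfer hB

end Summit.ValiantsHypothesis.ValiantsHypothesis.Theorems.NcOrderedTransfer

end
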